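import Summits.Ventures.LatticeQCDFlow.Scoring.AllPairsAcceptance
import Summits.Ventures.LatticeQCDFlow.Scoring.PairedDrawAcceptanceRatio
import HarnessLib

/-!
# The acceptance column from all pairs, II: the PRINTED (scale-free) all-pairs ratio with
# unnormalised weights — an exponential certificate from ONE proposal stream

HONEST FRAMING: exact (Metropolis-corrected) sampling algorithms for lattice gauge theory;
figures of merit are autocorrelation/cost numbers at stated couplings and volumes; no
continuum-physics claim.

Venture `LatticeQCDFlow` (cell pub-lqcd), topic `Scoring`; FANOUT row 4 (`s0-u1-b`, rung S0-B).
Sequel of `Scoring/AllPairsAcceptance` (the all-pairs U-statistic `Û` of `min(w, w')`, `w = p/q`,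
certified with NORMALISED weights) and of `Scoring/PairedDrawAcceptanceRatio` (the printed ratio for
DISJOINT pairs).  A code holds only UNNORMALISED weights `w̃ = c·w` (`c = Z` unknown) on its `n`
proposals `x₀,…,x_{n−1}` and prints the scale-free ratio

  `R = ( Σ_{i≠j} min(w̃(xᵢ), w̃(xⱼ)) / (n(n−1)) ) / ( Σ_j w̃(xⱼ) / n )`

— all-pairs mean of pair-minima over the mean weight, BOTH from the same `n` draws (nothing about
their dependence is needed: a union bound).  `R = Û/W̄` with the normalised statistics
(`PairedDraws.ratio_scale_free`); `E Û = acc(p,q)` (previous file), `E W̄ = ∫p = 1`; outside the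
four tail events (two for `Û`: `AllPairs.acceptance_allPairs_confidence`, Bernstein both sides,
`k = ⌊n/2⌋`; two for `W̄`: `PairedDraws.meanWeight_lower/upper`, Maurer with `M₂ = ∫p²/q = 1/ESS`
and Bernstein) the tree's deterministic ratio step `Scoring.abs_div_sub_lt_of_abs_sub_lt`
(`|Û − a| < t`, `|W̄ − 1| < u < 1`, `0 ≤ a ≤ 1` ⇒ `|Û/W̄ − a| < (t+u)/(1−u)`) applies:

* `printedAcceptance_allPairs_confidence` — `n ≥ 2` independent model draws, ceiling `p ≤ Wq`,
  `∫p²/q ≤ M₂` (`M₂ > 0`), any normalisation `c > 0`, `t > 0`, `0 < u < 1`: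
  `P( (t+u)/(1−u) ≤ |R − acc(p,q)| ) ≤ [e^{−⌊n/2⌋t²/(2(1+t/3))} + e^{−⌊n/2⌋t²/(2(1+Wt/3))}]
  + [e^{−nu²/(2M₂)} + e^{−nu²/(2(M₂+Wu/3))}]`.

Reading for row 4 (value-free; no number of ours, no sealed value): the all-pairs acceptance ratio a
code prints from `n` of its own proposals is a certified reading of its equilibrium acceptance; two
codes' printed ratios compare their acceptances with no parity hypothesis by the triangle
inequality exactly as in `AllPairs.acceptance_AB_allPairs_confidence`.  NEW WORK of the cell
(elementary); no definition.  NOT CLAIMED: estimating `M₂ = 1/ESS` or `W` (inputs; `M₂ ≤ W` always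
works); the realised acceptance rate of a finite chain; any number re-scored.
-/

noncomputable section

namespace Summit.Ventures.LatticeQCDFlow.Scoring.AllPairs

open MeasureTheory ProbabilityTheory Finset Real Set

variable {Ω : Type*} [MeasurableSpace Ω] {P : Measure Ω} [IsProbabilityMeasure P]
variable {X : Type*} [MeasurableSpace X] {μ : Measure X} [SFinite μ] {n : ℕ}

omit [MeasurableSpace Ω] [IsProbabilityMeasure P] [MeasurableSpace X] [SFinite μ] in
/-- **The printed all-pairs ratio is scale-free**: with `w̃ = c·(p/q)`, `c > 0`,
`(Σ_e min(w̃(x_{e0}), w̃(x_{e1}))/#(Fin 2 ↪ Fin n)) / (Σ_j w̃(xⱼ)/n)` equals the same ratio with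
the normalised weights (`PairedDraws.ratio_scale_free`). [ours] -/
theorem allPairsRatio_scale_free {p q wt : X → ℝ} {c : ℝ} (hc : 0 < c)
    (hwt : ∀ y, wt y = c * (p y / q y)) (v : Fin n → X) :
    ((∑ e : Fin 2 ↪ Fin n, min (wt (v (e 0))) (wt (v (e 1)))) / Fintype.card (Fin 2 ↪ Fin n))
        / ((∑ j : Fin n, wt (v j)) / n)
      = ((∑ e : Fin 2 ↪ Fin n, min (p (v (e 0)) / q (v (e 0))) (p (v (e 1)) / q (v (e 1))))
          / Fintype.card (Fin 2 ↪ Fin n)) / ((∑ j : Fin n, p (v j) / q (v j)) / n) := by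
  have h := PairedDraws.ratio_scale_free hc hwt (univ : Finset (Fin 2 ↪ Fin n))
    (univ : Finset (Fin n)) (fun e => v (e 0)) (fun e => v (e 1)) v
  simpa only [card_univ, Fintype.card_fin] using h

/-- **THE PRINTED ALL-PAIRS ACCEPTANCE RATIO IS A CERTIFIED READING OF `acc(p, q)`.**  `p ≥ 0`
normalised, `q > 0` a normalised model density, ceiling `p ≤ Wq`, `∫ p²/q ≤ M₂` (`M₂ > 0`);
`n ≥ 2` independent model draws `xⱼ`; weights printed with an arbitrary normalisation
`w̃ = c·p/q`, `c > 0`.  Then for `t > 0`, `0 < u < 1`, the printed ratio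
`R = (Σ_{i≠j} min(w̃(xᵢ), w̃(xⱼ))/(n(n−1))) / (Σ_j w̃(xⱼ)/n)` satisfies
`P( (t+u)/(1−u) ≤ |R − acc(p,q)| ) ≤ [e^{−⌊n/2⌋t²/(2(1+t/3))} + e^{−⌊n/2⌋t²/(2(1+Wt/3))}]
+ [e^{−nu²/(2M₂)} + e^{−nu²/(2(M₂+Wu/3))}]`. [ours] -/
theorem printedAcceptance_allPairs_confidence {x : Fin n → Ω → X} (hxm : ∀ i, Measurable (x i))
    (hind : iIndepFun x P) {p q : X → ℝ} (hp0 : ∀ z, 0 ≤ p z) (hpm : Measurable p)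
    (hpi : Integrable p μ) (hp1 : ∫ z, p z ∂μ = 1) (hq0 : ∀ z, 0 < q z) (hqm : Measurable q)
    (hqi : Integrable q μ) (hq1 : ∫ z, q z ∂μ = 1) {W : ℝ} (hW : ∀ z, p z ≤ W * q z) {M₂ : ℝ}
    (hM0 : 0 < M₂) (hM : ∫ z, p z ^ 2 / q z ∂μ ≤ M₂)
    (hlaw : ∀ i, Measure.map (x i) P = μ.withDensity fun z => ENNReal.ofReal (q z))
    {wt : X → ℝ} {c : ℝ} (hc : 0 < c) (hwt : ∀ z, wt z = c * (p z / q z)) (hn : 2 ≤ n)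
    {t u : ℝ} (ht : 0 < t) (hu : 0 < u) (hu1 : u < 1) :
    P.real {ω | (t + u) / (1 - u)
        ≤ |((∑ e : Fin 2 ↪ Fin n, min (wt (x (e 0) ω)) (wt (x (e 1) ω)))
              / Fintype.card (Fin 2 ↪ Fin n)) / ((∑ j : Fin n, wt (x j ω)) / n)
            - ∫ a, ∫ b, min (p a * q b) (p b * q a) ∂μ ∂μ|}
      ≤ (exp (-((n / 2 : ℕ) * t ^ 2 / (2 * (1 + t / 3))))
          + exp (-((n / 2 : ℕ) * t ^ 2 / (2 * (1 + W * t / 3)))))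
        + (exp (-(n * u ^ 2 / (2 * M₂))) + exp (-(n * u ^ 2 / (2 * (M₂ + W * u / 3))))) := by
  have hWpos : 0 < W := ceiling_pos (μ := μ) hp0 hp1 hq0 hW
  have hacc := PairedDraws.meanAccept_mem_Icc hp0 hpm hpi hp1 hq0 hqm hqi hq1
  have hU := acceptance_allPairs_confidence hxm hind hp0 hpm hpi hp1 hq0 hqm hqi hW hlaw hn ht
  have hn0 : 0 < (univ : Finset (Fin n)).card := by
    rw [card_univ, Fintype.card_fin]; omega
  have hWlo' := PairedDraws.meanWeight_lower hxm hind hp0 hpm hp1 hq0 hqm hW hM hlaw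
    (univ : Finset (Fin n)) hu.le
  have hWup' := PairedDraws.meanWeight_upper hxm hind hp0 hpm hp1 hq0 hqm hWpos hW hM0 hM hlaw
    (univ : Finset (Fin n)) hn0 hu
  simp only [card_univ, Fintype.card_fin] at hWlo' hWup'
  have hn' : (0 : ℝ) < n := by exact_mod_cast (show 0 < n by omega)
  set acc : ℝ := ∫ a, ∫ b, min (p a * q b) (p b * q a) ∂μ ∂μ with hacc_def
  set U : Ω → ℝ := fun ω =>
    (∑ e : Fin 2 ↪ Fin n, min (p (x (e 0) ω) / q (x (e 0) ω)) (p (x (e 1) ω) / q (x (e 1) ω)))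
      / Fintype.card (Fin 2 ↪ Fin n) with hUdef
  set Sw : Ω → ℝ := fun ω => ∑ j : Fin n, p (x j ω) / q (x j ω) with hSw
  have hR : ∀ ω, ((∑ e : Fin 2 ↪ Fin n, min (wt (x (e 0) ω)) (wt (x (e 1) ω)))
        / Fintype.card (Fin 2 ↪ Fin n)) / ((∑ j : Fin n, wt (x j ω)) / n)
      = U ω / (Sw ω / n) := fun ω => allPairsRatio_scale_free hc hwt fun j => x j ω
  have hsub : {ω | (t + u) / (1 - u)
        ≤ |((∑ e : Fin 2 ↪ Fin n, min (wt (x (e 0) ω)) (wt (x (e 1) ω)))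
              / Fintype.card (Fin 2 ↪ Fin n)) / ((∑ j : Fin n, wt (x j ω)) / n) - acc|}
      ⊆ {ω | t ≤ |U ω - acc|}
        ∪ ({ω | Sw ω + n * u ≤ n * 1} ∪ {ω | n * (1 + u) ≤ Sw ω}) := by
    intro ω hω
    simp only [mem_setOf_eq, mem_union] at hω ⊢
    rw [hR ω] at hω
    by_contra hcon
    simp only [not_or, not_le] at hcon
    obtain ⟨h1, h2, h3⟩ := hcon
    have hWb : |Sw ω / n - 1| < u := by
      rw [abs_lt]
      constructor
      · have : n * (1 - u) < Sw ω := by linarith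
        rw [← lt_div_iff₀' hn'] at this
        linarith
      · have : Sw ω < n * (1 + u) := h3
        rw [← div_lt_iff₀' hn'] at this
        linarith
    have key := abs_div_sub_lt_of_abs_sub_lt hacc.1 hacc.2 hu1 h1 hWb
    linarith
  calc P.real {ω | (t + u) / (1 - u)
          ≤ |((∑ e : Fin 2 ↪ Fin n, min (wt (x (e 0) ω)) (wt (x (e 1) ω)))
                / Fintype.card (Fin 2 ↪ Fin n)) / ((∑ j : Fin n, wt (x j ω)) / n) - acc|}
      ≤ P.real ({ω | t ≤ |U ω - acc|}
          ∪ ({ω | Sw ω + n * u ≤ n * 1} ∪ {ω | n * (1 + u) ≤ Sw ω})) := measureReal_mono hsub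
    _ ≤ P.real {ω | t ≤ |U ω - acc|}
          + P.real ({ω | Sw ω + n * u ≤ n * 1} ∪ {ω | n * (1 + u) ≤ Sw ω}) :=
        measureReal_union_le _ _
    _ ≤ P.real {ω | t ≤ |U ω - acc|}
          + (P.real {ω | Sw ω + n * u ≤ n * 1} + P.real {ω | n * (1 + u) ≤ Sw ω}) :=
        add_le_add le_rfl (measureReal_union_le _ _)
    _ ≤ _ := add_le_add hU (add_le_add hWlo' hWup')

/-! ## The A-vs-B comparison of two PRINTED all-pairs ratios (appended) -/

/-- **A-vs-B ACCEPTANCE COMPARISON FROM TWO PRINTED ALL-PAIRS RATIOS, NO PARITY HYPOTHESIS.**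
One normalised target `p ≥ 0`; two codes with normalised model densities `q, q' > 0`, ceilings
`p ≤ Wq`, `p ≤ W'q'`, second weight moments `∫p²/q ≤ M₂`, `∫p²/q' ≤ M₂'`; code A prints its ratio
`R` from `n ≥ 2` own draws with weights `w̃ = c·p/q` (`c > 0` unknown), code B prints `R'` from
`n' ≥ 2` own draws with `w̃' = c'·p/q'`; nothing is assumed between the streams.  For `t, t' > 0`,
`0 < u, u' < 1`: `P( (t+u)/(1−u) + (t'+u')/(1−u') ≤ |(R − R') − (acc(p,q) − acc(p,q'))| )` is at
most the sum of the two bounds of `printedAcceptance_allPairs_confidence`. [ours] -/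
theorem printedAcceptance_AB_allPairs_confidence {p q q' : X → ℝ} (hp0 : ∀ z, 0 ≤ p z)
    (hpm : Measurable p) (hpi : Integrable p μ) (hp1 : ∫ z, p z ∂μ = 1) (hq0 : ∀ z, 0 < q z)
    (hqm : Measurable q) (hqi : Integrable q μ) (hq1 : ∫ z, q z ∂μ = 1) (hq0' : ∀ z, 0 < q' z)
    (hqm' : Measurable q') (hqi' : Integrable q' μ) (hq1' : ∫ z, q' z ∂μ = 1) {W W' : ℝ}
    (hW : ∀ z, p z ≤ W * q z) (hW' : ∀ z, p z ≤ W' * q' z) {M₂ M₂' : ℝ} (hM0 : 0 < M₂)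
    (hM : ∫ z, p z ^ 2 / q z ∂μ ≤ M₂) (hM0' : 0 < M₂') (hM' : ∫ z, p z ^ 2 / q' z ∂μ ≤ M₂')
    {n n' : ℕ} {x : Fin n → Ω → X} (hxm : ∀ i, Measurable (x i)) (hind : iIndepFun x P)
    (hlaw : ∀ i, Measure.map (x i) P = μ.withDensity fun z => ENNReal.ofReal (q z))
    {y : Fin n' → Ω → X} (hym : ∀ j, Measurable (y j)) (hindy : iIndepFun y P)
    (hlawy : ∀ j, Measure.map (y j) P = μ.withDensity fun z => ENNReal.ofReal (q' z))
    {wt wt' : X → ℝ} {c c' : ℝ} (hc : 0 < c) (hwt : ∀ z, wt z = c * (p z / q z)) (hc' : 0 < c')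
    (hwt' : ∀ z, wt' z = c' * (p z / q' z)) (hn : 2 ≤ n) (hn' : 2 ≤ n') {t u t' u' : ℝ}
    (ht : 0 < t) (hu : 0 < u) (hu1 : u < 1) (ht' : 0 < t') (hu' : 0 < u') (hu1' : u' < 1) :
    P.real {ω | (t + u) / (1 - u) + (t' + u') / (1 - u')
        ≤ |(((∑ e : Fin 2 ↪ Fin n, min (wt (x (e 0) ω)) (wt (x (e 1) ω)))
                / Fintype.card (Fin 2 ↪ Fin n)) / ((∑ j : Fin n, wt (x j ω)) / n)
            - ((∑ e : Fin 2 ↪ Fin n', min (wt' (y (e 0) ω)) (wt' (y (e 1) ω)))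
                / Fintype.card (Fin 2 ↪ Fin n')) / ((∑ j : Fin n', wt' (y j ω)) / n'))
            - ((∫ a, ∫ b, min (p a * q b) (p b * q a) ∂μ ∂μ)
              - ∫ a, ∫ b, min (p a * q' b) (p b * q' a) ∂μ ∂μ)|}
      ≤ ((exp (-((n / 2 : ℕ) * t ^ 2 / (2 * (1 + t / 3))))
            + exp (-((n / 2 : ℕ) * t ^ 2 / (2 * (1 + W * t / 3)))))
          + (exp (-(n * u ^ 2 / (2 * M₂))) + exp (-(n * u ^ 2 / (2 * (M₂ + W * u / 3))))))
        + ((exp (-((n' / 2 : ℕ) * t' ^ 2 / (2 * (1 + t' / 3))))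
            + exp (-((n' / 2 : ℕ) * t' ^ 2 / (2 * (1 + W' * t' / 3)))))
          + (exp (-(n' * u' ^ 2 / (2 * M₂')))
            + exp (-(n' * u' ^ 2 / (2 * (M₂' + W' * u' / 3)))))) := by
  have hA := printedAcceptance_allPairs_confidence hxm hind hp0 hpm hpi hp1 hq0 hqm hqi hq1 hW hM0
    hM hlaw hc hwt hn ht hu hu1
  have hB := printedAcceptance_allPairs_confidence hym hindy hp0 hpm hpi hp1 hq0' hqm' hqi' hq1'
    hW' hM0' hM' hlawy hc' hwt' hn' ht' hu' hu1'
  set acc : ℝ := ∫ a, ∫ b, min (p a * q b) (p b * q a) ∂μ ∂μ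
  set acc' : ℝ := ∫ a, ∫ b, min (p a * q' b) (p b * q' a) ∂μ ∂μ
  set R : Ω → ℝ := fun ω => ((∑ e : Fin 2 ↪ Fin n, min (wt (x (e 0) ω)) (wt (x (e 1) ω)))
    / Fintype.card (Fin 2 ↪ Fin n)) / ((∑ j : Fin n, wt (x j ω)) / n)
  set R' : Ω → ℝ := fun ω => ((∑ e : Fin 2 ↪ Fin n', min (wt' (y (e 0) ω)) (wt' (y (e 1) ω)))
    / Fintype.card (Fin 2 ↪ Fin n')) / ((∑ j : Fin n', wt' (y j ω)) / n')
  set r : ℝ := (t + u) / (1 - u)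
  set r' : ℝ := (t' + u') / (1 - u')
  have hsub : {ω | r + r' ≤ |(R ω - R' ω) - (acc - acc')|}
      ⊆ {ω | r ≤ |R ω - acc|} ∪ {ω | r' ≤ |R' ω - acc'|} := by
    intro ω hω
    simp only [mem_setOf_eq, mem_union] at hω ⊢
    by_contra hcon
    obtain ⟨h1, h2⟩ := not_or.mp hcon
    have : |(R ω - R' ω) - (acc - acc')| ≤ |R ω - acc| + |R' ω - acc'| := by
      rw [show (R ω - R' ω) - (acc - acc') = (R ω - acc) - (R' ω - acc') by ring]
      exact abs_sub _ _
    linarith [not_le.mp h1, not_le.mp h2]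
  calc P.real {ω | r + r' ≤ |(R ω - R' ω) - (acc - acc')|}
      ≤ P.real ({ω | r ≤ |R ω - acc|} ∪ {ω | r' ≤ |R' ω - acc'|}) := measureReal_mono hsub
    _ ≤ P.real {ω | r ≤ |R ω - acc|} + P.real {ω | r' ≤ |R' ω - acc'|} :=
        measureReal_union_le _ _
    _ ≤ _ := add_le_add hA hB

end Summit.Ventures.LatticeQCDFlow.Scoring.AllPairs

end
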